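import Summits.CriticalPhenomena.Ising3DConformalLimit.Theses.MonotoneBlocking
import Summits.CriticalPhenomena.Ising3DConformalLimit.Theorems.HyperoctahedralRPExistsScaleCovariantLimitBlockLimitsGiveCrux
import Summits.CriticalPhenomena.Ising3DConformalLimit.Theorems.HyperoctahedralRPExistsScaleCovariantLimitMonotoneBlockingOdd
import HarnessLib

/-!
# Monotone blocking gives the scale-covariant scaling limit
(route `MonotoneBlocking`, sub-problem `CriticalPhenomena/Ising3DConformalLimit`; support item
stmt-CriticalPhenomena-17057 `BlockingGivesLimit`)

`BlockingGivesLimit` reads: BM₂ → BM_mom → (the text of item 4658 `UniformRegularity`) →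
(the text of the crux `ExistsScaleCovariantLimit`, item 1981), where, for the critical nearest-neighbour
Ising model on `ℤ³`, `S_L(Lk)` the spin sum over the block `Lk + [0,L)³`,
* BM₂ (`MonotoneBlocking.MonotoneBlockingTwo`): `⟨S_L(0)S_L(Lk)⟩·⟨S_{L+1}²⟩ ≤ ⟨S_{L+1}(0)S_{L+1}((L+1)k)⟩·⟨S_L²⟩`
  for all `L ≥ 1`, `k ∈ ℤ³` — the block correlation ratio `ρ(L;k) = C(L;k)/V(L)` is non-decreasing in `L`;
* BM_mom (`MonotoneBlocking.MonotoneBlockingMoments`): the same for the even normalised block moments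
  `⟨∏ᵢ S_L(Lkᵢ)⟩/⟨S_L²⟩^m` at pairwise SUP-SEPARATED offsets (`|kᵢ(c) − kⱼ(c)| ≥ 2` for some coordinate `c`).

The proof is glue onto the landed line `monotone-blocking-port` of the crux (namespace
`…Cruxes.ExistsScaleCovariantLimit.MonotoneBlockingPort`, files `Theorems/HyperoctahedralRPExistsScaleCovariantLimit*`):
1. BRIDGES (`monotoneBlockingTwo_iff`, `monotoneBlockingMoments_iff`): the route's `let`-bound block sums are the
   tree's `blockCov` / numerator of `critBlockMoment` (swap of summation variables, `add_comm`).
2. BM₂ ⟹ `L ↦ R₂(L;k⃗)` monotone on `L ≥ 1`; with the landed bound S3 (`stub_blockMomentBounded`, Griffiths + Newman)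
   it converges: `BlockTwoLimits`, whence `TwoPointScaling` (landed S4c `twoPointScaling_of_blockTwoLimits_holds`).
   BM_mom ⟹ the even block moments at sup-separated offsets converge likewise; odd orders vanish identically.
3. THE ONE NEW STEP (`intMeshConvergence_of_sepBlockLimits`): the landed de-smearing stub S5
   (`stub_intMesh_of_blockLimits`) consumes block limits at ALL injective offsets, which BM_mom does not supply
   (adjacent blocks). But its proof only ever evaluates block moments at the DILATED offsets `j z⃗` (`z⃗` an
   injective integer configuration, `j` the block parameter), and choosing `j ≥ 2` makes these sup-separated by
   `≥ j ≥ 2` (`sep_of_smul_injective`). We re-run the S5 argument verbatim with `j := j₀ + 2`.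
4. `crux_iff_intMeshConvergence` (landed) turns integer-mesh convergence into the crux, whose text is the
   conclusion verbatim; the hypothesis (text of `MonotoneRG.UniformRegularity`) feeds step 3.

References: A. Messager, S. Miracle-Solé, J. Stat. Phys. 17 (1977); C. M. Newman, Z. Wahrsch. 33 (1975) (behind the
landed S3/S4); H. Duminil-Copin, ICM 2022 §8.4 (the existence problem). Everything here is folklore soft analysis;
no definitions, no named-fact hypotheses, no `sorry`.
-/

noncomputable section

namespace Summit.CriticalPhenomena.Ising3DConformalLimit.MonotoneBlockingLimit

open Literature.Probability.LatticeModels Filter Set Finset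
open scoped Topology BigOperators
open Summit.CriticalPhenomena.Ising3DConformalLimit.MoebiusLimitExistsOnlyInteraction (rhoPin)
open Summit.CriticalPhenomena.Ising3DConformalLimit.Theses
open Summit.CriticalPhenomena.Ising3DConformalLimit.Cruxes.ExistsScaleCovariantLimit.MonotoneBlockingPort
open Summit.CriticalPhenomena.Ising3DConformalLimit.Cruxes.ExistsScaleCovariantLimit.TwoHierarchies
  (rhoStar_eq_rhoPin crux_iff_intMeshConvergence)
open Summit.CriticalPhenomena.Ising3DConformalLimit.MonotoneRGZoomGlue
  (tendsto_of_eventually_monotone_of_bounded)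

/-! ### Bridges: the route's `let`-bound block sums are the tree's `blockCov` / `critBlockMoment` numerator -/

/-- The route's block covariance `Σ_{x,y ∈ cube L} ⟨σ_{Lk+x} σ_y⟩` (written `G(Lk + x − y)`) is the tree's
`blockCov L k = Σ_{x,y ∈ cube L} G(y − x + Lk)` (swap the two summation variables). [folklore] -/
theorem route_bc_eq_blockCov (L : ℕ) (k : Site 3) :
    ∑ x ∈ Fintype.piFinset (fun _ : Fin 3 => Finset.Ico (0:ℤ) (L:ℤ)),
      ∑ y ∈ Fintype.piFinset (fun _ : Fin 3 => Finset.Ico (0:ℤ) (L:ℤ)),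
        criticalTwoPoint 3 ((L:ℤ) • k + x - y) = blockCov L k := by
  show ∑ x ∈ cube L, ∑ y ∈ cube L, criticalTwoPoint 3 ((L:ℤ) • k + x - y) = _
  rw [blockCov, Finset.sum_comm]
  refine Finset.sum_congr rfl fun y _ => Finset.sum_congr rfl fun x _ => ?_
  congr 1
  abel

/-- The route's block variance `Σ_{x,y ∈ cube L} G(x − y)` is `V(L) = blockCov L 0`. [folklore] -/
theorem route_bc0_eq_blockCov (L : ℕ) :
    ∑ x ∈ Fintype.piFinset (fun _ : Fin 3 => Finset.Ico (0:ℤ) (L:ℤ)),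
      ∑ y ∈ Fintype.piFinset (fun _ : Fin 3 => Finset.Ico (0:ℤ) (L:ℤ)),
        criticalTwoPoint 3 (x - y) = blockCov L 0 := by
  show ∑ x ∈ cube L, ∑ y ∈ cube L, criticalTwoPoint 3 (x - y) = _
  rw [blockCov_zero_eq, Finset.sum_comm]

/-- The route's block moment numerator `Σ_{xᵢ ∈ cube L} ⟨∏ᵢ σ_{Lkᵢ + xᵢ}⟩` is the tree's numerator
`Σ_{xᵢ ∈ cube L} ⟨∏ᵢ σ_{xᵢ + Lkᵢ}⟩` of `critBlockMoment`. [folklore] -/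
theorem route_bm_eq (n L : ℕ) (k : Fin n → Site 3) :
    ∑ x ∈ Fintype.piFinset (fun _ : Fin n => Fintype.piFinset (fun _ : Fin 3 => Finset.Ico (0:ℤ) (L:ℤ))),
      criticalCorr 3 n (fun i => (L:ℤ) • k i + x i) =
    ∑ x ∈ Fintype.piFinset (fun _ : Fin n => cube L), criticalCorr 3 n (fun i => x i + (L:ℤ) • k i) := by
  show ∑ x ∈ Fintype.piFinset (fun _ : Fin n => cube L), criticalCorr 3 n (fun i => (L:ℤ) • k i + x i) = _
  refine Finset.sum_congr rfl fun x _ => ?_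
  congr 1
  funext i
  exact add_comm _ _

/-- `R_n(L; k⃗) · V(L)^{n/2}` is the numerator, and at even order `n = 2m` the real power is `V(L)^m`.
[folklore] -/
theorem critBlockMoment_even_eq (m L : ℕ) (k : Fin (2 * m) → Site 3) :
    critBlockMoment (2 * m) L k =
      (∑ x ∈ Fintype.piFinset (fun _ : Fin (2 * m) => cube L),
        criticalCorr 3 (2 * m) (fun i => x i + (L:ℤ) • k i)) / blockCov L 0 ^ m := by
  have hpow : blockCov L 0 ^ (((2 * m : ℕ) : ℝ) / 2) = blockCov L 0 ^ m := by
    rw [Nat.cast_mul, Nat.cast_ofNat, mul_div_cancel_left₀ _ (two_ne_zero' ℝ), Real.rpow_natCast]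
  rw [critBlockMoment, hpow]

/-- BM₂ unfolded against the tree's vocabulary: `C(L;k) V(L+1) ≤ C(L+1;k) V(L)` for `L ≥ 1`. [folklore] -/
theorem monotoneBlockingTwo_iff :
    MonotoneBlocking.MonotoneBlockingTwo ↔
      ∀ L : ℕ, 1 ≤ L → ∀ k : Site 3,
        blockCov L k * blockCov (L + 1) 0 ≤ blockCov (L + 1) k * blockCov L 0 := by
  unfold MonotoneBlocking.MonotoneBlockingTwo
  simp only [route_bc_eq_blockCov]

/-- BM_mom unfolded against the tree's vocabulary. [folklore] -/
theorem monotoneBlockingMoments_iff :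
    MonotoneBlocking.MonotoneBlockingMoments ↔
      ∀ (m : ℕ) (k : Fin (2 * m) → Site 3), (∀ i j, i ≠ j → ∃ c : Fin 3, (2:ℤ) ≤ |k i c - k j c|) →
        ∀ L : ℕ, 1 ≤ L →
          (∑ x ∈ Fintype.piFinset (fun _ : Fin (2 * m) => cube L),
              criticalCorr 3 (2 * m) (fun i => x i + (L:ℤ) • k i)) * blockCov (L + 1) 0 ^ m ≤
            (∑ x ∈ Fintype.piFinset (fun _ : Fin (2 * m) => cube (L + 1)),
              criticalCorr 3 (2 * m) (fun i => x i + ((L + 1 : ℕ) : ℤ) • k i)) * blockCov L 0 ^ m := by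
  unfold MonotoneBlocking.MonotoneBlockingMoments
  simp only [route_bc0_eq_blockCov, route_bm_eq]

/-! ### BM ⟹ monotone, bounded, hence convergent block moments -/

/-- BM₂ ⟹ every block two-point ratio `L ↦ R₂(L; (k₀,k₁)) = C(L; k₁−k₀)/V(L)` is non-decreasing on `L ≥ 1`.
[folklore] -/
theorem monotoneOn_critBlockMoment_two (h : MonotoneBlocking.MonotoneBlockingTwo) (k : Fin 2 → Site 3) :
    MonotoneOn (fun L : ℕ => critBlockMoment 2 L k) (Set.Ici 1) := by
  rw [monotoneBlockingTwo_iff] at h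
  refine monotoneOn_nat_Ici_of_le_succ fun L hL => ?_
  have hV := blockCov_zero_pos L hL
  have hV' := blockCov_zero_pos (L + 1) (by omega)
  simp only [critBlockMoment_two]
  rw [div_le_div_iff₀ hV hV']
  exact h L hL (k 1 - k 0)

/-- BM_mom ⟹ every even block moment `L ↦ R_{2m}(L; k⃗)` at pairwise sup-separated offsets (`≥ 2` in some
coordinate) is non-decreasing on `L ≥ 1`. [folklore] -/
theorem monotoneOn_critBlockMoment_even (h : MonotoneBlocking.MonotoneBlockingMoments) (m : ℕ)
    (k : Fin (2 * m) → Site 3) (hk : ∀ i j, i ≠ j → ∃ c : Fin 3, (2:ℤ) ≤ |k i c - k j c|) :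
    MonotoneOn (fun L : ℕ => critBlockMoment (2 * m) L k) (Set.Ici 1) := by
  rw [monotoneBlockingMoments_iff] at h
  refine monotoneOn_nat_Ici_of_le_succ fun L hL => ?_
  have hV := blockCov_zero_pos L hL
  have hV' := blockCov_zero_pos (L + 1) (by omega)
  simp only [critBlockMoment_even_eq]
  rw [div_le_div_iff₀ (pow_pos hV m) (pow_pos hV' m)]
  exact h m k hk L hL

/-- BM₂ ⟹ `BlockTwoLimits`: monotone (BM₂) and bounded (landed S3 `stub_blockMomentBounded`) real sequences
converge. [folklore] -/
theorem blockTwoLimits_of_monotoneBlockingTwo (h : MonotoneBlocking.MonotoneBlockingTwo) : BlockTwoLimits := by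
  intro k _
  obtain ⟨C, hC⟩ := stub_blockMomentBounded 2 k
  exact tendsto_of_eventually_monotone_of_bounded (Or.inl (monotoneOn_critBlockMoment_two h k))
    ((eventually_ge_atTop 1).mono fun L hL => hC L hL)

/-- BM_mom ⟹ SEPARATED BLOCK LIMITS: every block moment of order `n ≥ 2` at pairwise sup-separated offsets
converges as `L → ∞` (odd orders vanish identically; even orders are monotone and bounded). [folklore] -/
theorem sepBlockLimits_of_monotoneBlockingMoments (h2 : MonotoneBlocking.MonotoneBlockingMoments) :
    ∀ n : ℕ, 2 ≤ n → ∀ k : Fin n → Site 3, (∀ i j, i ≠ j → ∃ c : Fin 3, (2:ℤ) ≤ |k i c - k j c|) →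
      ∃ M : ℝ, Tendsto (fun L : ℕ => critBlockMoment n L k) atTop (𝓝 M) := by
  intro n hn k hk
  rcases Nat.even_or_odd n with he | ho
  · obtain ⟨m, hm⟩ := he
    obtain rfl : n = 2 * m := by omega
    obtain ⟨C, hC⟩ := stub_blockMomentBounded (2 * m) k
    exact tendsto_of_eventually_monotone_of_bounded (Or.inl (monotoneOn_critBlockMoment_even h2 m k hk))
      ((eventually_ge_atTop 1).mono fun L hL => hC L hL)
  · exact ⟨0, tendsto_const_nhds.congr fun L => (critBlockMoment_eq_zero_of_odd ho L k).symm⟩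

/-! ### De-smearing needs block limits at SEPARATED offsets only -/

/-- A real sequence which, for every `ε > 0`, is eventually `ε`-close to SOME convergent sequence is Cauchy,
hence convergent. [folklore] -/
private theorem exists_tendsto_of_forall_close {F : ℕ → ℝ}
    (h : ∀ ε > 0, ∃ (A : ℕ → ℝ) (a : ℝ), Tendsto A atTop (𝓝 a) ∧ ∀ᶠ m in atTop, |F m - A m| ≤ ε) :
    ∃ l : ℝ, Tendsto F atTop (𝓝 l) := by
  refine cauchySeq_tendsto_of_complete (Metric.cauchySeq_iff.2 fun ε hε => ?_)
  obtain ⟨A, a, hA, hclose⟩ := h (ε / 4) (by positivity)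
  have hA' : ∀ᶠ m in atTop, |A m - a| < ε / 4 := by
    have h1 := (Metric.tendsto_nhds.1 hA) (ε / 4) (by positivity)
    exact h1.mono fun m hm => by rwa [← Real.dist_eq]
  obtain ⟨N, hN⟩ := eventually_atTop.1 (hclose.and hA')
  refine ⟨N, fun m hm m' hm' => ?_⟩
  obtain ⟨hm1, hm2⟩ := hN m hm
  obtain ⟨hn1, hn2⟩ := hN m' hm'
  rw [Real.dist_eq, abs_sub_lt_iff]
  obtain ⟨h1, h1'⟩ := abs_le.1 hm1
  obtain ⟨h2, h2'⟩ := abs_lt.1 hm2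
  obtain ⟨h3, h3'⟩ := abs_le.1 hn1
  obtain ⟨h4, h4'⟩ := abs_lt.1 hn2
  constructor <;> linarith

/-- Dilating an injective integer configuration `z` by an integer `j ≥ 2` gives pairwise SUP-SEPARATED block offsets:
for `i ≠ i'` some coordinate of `j zᵢ − j zᵢ'` has absolute value `≥ j ≥ 2`. [folklore] -/
theorem sep_of_smul_injective {n : ℕ} {z : Fin n → Site 3} (hz : Function.Injective z) {j : ℕ} (hj : 2 ≤ j) :
    ∀ i i', i ≠ i' → ∃ c : Fin 3, (2:ℤ) ≤ |((j : ℤ) • z i) c - ((j : ℤ) • z i') c| := by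
  intro i i' hii'
  have hne : z i ≠ z i' := fun h => hii' (hz h)
  obtain ⟨c, hc⟩ : ∃ c, z i c ≠ z i' c := by
    by_contra hall
    push Not at hall
    exact hne (funext hall)
  refine ⟨c, ?_⟩
  have h1 : (1:ℤ) ≤ |z i c - z i' c| := Int.one_le_abs (sub_ne_zero.2 hc)
  have hj' : (2:ℤ) ≤ (j:ℤ) := by exact_mod_cast hj
  simp only [Pi.smul_apply, smul_eq_mul]
  rw [← mul_sub, abs_mul, Nat.abs_cast]
  nlinarith

/-- **De-smearing from SEPARATED block limits**: if every block moment of order `n ≥ 2` at pairwise sup-separated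
offsets converges as `L → ∞`, then (with two-point scaling and the equicontinuity of item 4658) the pinned zoom
converges along the integer meshes at every non-coincident integer configuration (`IntMeshConvergence`). This is the
landed S5 `stub_intMesh_of_blockLimits` re-run with block parameter `j ≥ 2`, so that the only block offsets ever
used, `j z⃗` with `z⃗` injective, are sup-separated by `≥ j ≥ 2`. [folklore] -/
theorem intMeshConvergence_of_sepBlockLimits
    (hBL : ∀ n : ℕ, 2 ≤ n → ∀ k : Fin n → Site 3, (∀ i j, i ≠ j → ∃ c : Fin 3, (2:ℤ) ≤ |k i c - k j c|) →
      ∃ M : ℝ, Tendsto (fun L : ℕ => critBlockMoment n L k) atTop (𝓝 M))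
    (hTS : TwoPointScaling) (hUR : MonotoneRG.UniformRegularity) : IntMeshConvergence := by
  unfold MonotoneRG.UniformRegularity at hUR
  unfold IntMeshConvergence
  intro n y hy hint
  rw [rhoStar_eq_rhoPin] at hUR
  choose z hz using hint
  rcases Nat.even_or_odd n with hn | hn
  swap
  · -- odd orders vanish identically
    refine ⟨0, tendsto_const_nhds.congr fun m => ?_⟩
    rw [rescaledCorrelator_apply, criticalCorr_eq_zero_of_odd (d := 3) le_rfl hn, mul_zero]
  obtain ⟨p, hp⟩ := hn
  rcases Nat.eq_zero_or_pos p with hp0 | hp0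
  · -- order `0`: a constant sequence
    have hn0 : n = 0 := by omega
    subst hn0
    refine ⟨rescaledCorrelator (criticalCorr 3) rhoPin 0 (1 / ((0 : ℕ) : ℝ)) y,
      tendsto_const_nhds.congr fun m => ?_⟩
    simp only [rescaledCorrelator_apply, pow_zero, one_mul]
    exact congrArg _ (Subsingleton.elim _ _)
  have hn2 : n = 2 * p := by omega
  subst hn2
  -- `z` is injective since `y` is
  have hz_inj : Function.Injective z := by
    intro i i' h
    refine (mem_nonCoincident y).1 hy (PiLp.ext fun k => ?_)
    rw [hz i k, hz i' k, h]
  -- (1) a compact ball around `y` inside `NonCoincident`, and clause (b) on it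
  obtain ⟨r₀, hr₀, hball⟩ : ∃ r₀, 0 < r₀ ∧ Metric.closedBall y r₀ ⊆ NonCoincident 3 (2 * p) :=
    Metric.nhds_basis_closedBall.mem_iff.1 ((isOpen_nonCoincident 3 (2 * p)).mem_nhds hy)
  obtain ⟨-, hequi⟩ := hUR.1 (2 * p) (Metric.closedBall y r₀) hball (isCompact_closedBall y r₀)
  -- a coordinate bound `Z`
  obtain ⟨Z, hZ⟩ := Finite.exists_le (fun q : Fin (2 * p) × Fin 3 => (z q.1 q.2).natAbs)
  refine exists_tendsto_of_forall_close fun ε hε => ?_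
  obtain ⟨r, δ₀, hr, hδ₀, hcont⟩ := hequi ε hε
  have hr' : 0 < min r r₀ := lt_min hr hr₀
  -- (2) the block parameter `j > 4 / min r r₀`, `j ≥ 2`
  obtain ⟨j₀, hj₀⟩ := exists_nat_gt (4 / min r r₀)
  set j : ℕ := j₀ + 2 with hjdef
  have hj2 : 2 ≤ j := by omega
  have hj : 4 / min r r₀ < (j : ℝ) := by
    refine lt_of_lt_of_le hj₀ ?_
    exact_mod_cast (by omega : j₀ ≤ j)
  have hjR : (0 : ℝ) < j := lt_trans (by positivity) hj
  have hjpos : 0 < j := by exact_mod_cast hjR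
  -- block offsets `j • z`, sup-separated; their block limit
  obtain ⟨Mlim, hM⟩ := hBL (2 * p) (by omega) (fun i => (j : ℤ) • z i) (sep_of_smul_injective hz_inj hj2)
  obtain ⟨c, hc⟩ := tendsto_blockCov_div_of_twoPointScaling hTS hjpos
  have hLt : Tendsto (fun m : ℕ => m / j) atTop atTop := Nat.tendsto_div_const_atTop hjpos.ne'
  -- (3) the approximants `A(m) = R_{2p}(⌊m/j⌋; j z⃗) · (V/(L⁶ g(m)))^p`
  refine ⟨fun m => critBlockMoment (2 * p) (m / j) (fun i => (j : ℤ) • z i) *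
      (blockCov (m / j) 0 / (((m / j : ℕ) : ℝ) ^ 6 * criticalTwoPoint 3 (Pi.single 0 (m : ℤ)))) ^ p,
    Mlim * c ^ p, (hM.comp hLt).mul (hc.pow p), ?_⟩
  -- (4) eventual `ε`-closeness
  have hev1 : ∀ᶠ m : ℕ in atTop, 1 / (m : ℝ) < δ₀ :=
    tendsto_one_div_atTop_nhds_zero_nat.eventually (gt_mem_nhds hδ₀)
  have hev2 : ∀ᶠ m : ℕ in atTop, 2 * (1 / (j : ℝ) + (j : ℝ) * Z / (m : ℝ)) < min r r₀ := by
    have ht : Tendsto (fun m : ℕ => 2 * (1 / (j : ℝ) + (j : ℝ) * Z / (m : ℝ))) atTop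
        (𝓝 (2 * (1 / (j : ℝ) + 0))) :=
      (tendsto_const_nhds.add (tendsto_const_div_atTop_nhds_zero_nat _)).const_mul 2
    refine ht.eventually (gt_mem_nhds ?_)
    have h4 := (div_lt_iff₀ hr').1 hj
    rw [add_zero, mul_one_div, div_lt_iff₀ hjR]
    linarith
  filter_upwards [eventually_ge_atTop j, hev1, hev2] with m hmj hmδ hmr
  have hm : 0 < m := lt_of_lt_of_le hjpos hmj
  have hmR : (0 : ℝ) < m := by exact_mod_cast hm
  have hL1 : 1 ≤ m / j := (Nat.le_div_iff_mul_le hjpos).2 (by simpa using hmj)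
  have hLpos : (0 : ℝ) < ((m / j : ℕ) : ℝ) := by exact_mod_cast hL1
  set L := m / j with hL
  set S := Fintype.piFinset (fun _ : Fin (2 * p) => cube L) with hS
  set X : (Fin (2 * p) → Site 3) → Fin (2 * p) → EuclideanSpace ℝ (Fin 3) := fun x i =>
    WithLp.toLp 2 fun k' => (((x i + (L : ℤ) • ((j : ℤ) • z i)) k' : ℤ) : ℝ) / (m : ℝ) with hX
  set G : (Fin (2 * p) → Site 3) → ℝ := fun x =>
    rescaledCorrelator (criticalCorr 3) rhoPin (2 * p) (1 / (m : ℝ)) (X x) with hG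
  -- every block configuration is `ε`-close in value (clause (b))
  have hclose : ∀ x ∈ S,
      |G x - rescaledCorrelator (criticalCorr 3) rhoPin (2 * p) (1 / (m : ℝ)) y| < ε := by
    intro x hx
    have hdist : dist (X x) y < min r r₀ :=
      dist_blockConfig_lt hz (fun i k => hZ (i, k)) hjpos hm hmr hx
    exact hcont (1 / (m : ℝ)) ⟨one_div_pos.2 hmR, hmδ⟩ (X x)
      (Metric.mem_closedBall.2 (hdist.le.trans (min_le_right _ _))) y
      (Metric.mem_closedBall_self hr₀.le) (lt_of_lt_of_le hdist (min_le_left _ _))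
  -- the de-smearing identity and the number of block configurations
  have hsum : ∑ x ∈ S, G x = ((L : ℝ) ^ 3) ^ (2 * p) *
      (critBlockMoment (2 * p) L (fun i => (j : ℤ) • z i) *
        (blockCov L 0 / ((L : ℝ) ^ 6 * criticalTwoPoint 3 (Pi.single 0 (m : ℤ)))) ^ p) :=
    sum_rescaledCorrelator_blockConfig hL1 hm.ne' _
  have hcard : (S.card : ℝ) = ((L : ℝ) ^ 3) ^ (2 * p) := by
    rw [hS, Fintype.card_piFinset_const, card_cube]
    push_cast
    ring
  have hc0 : ((L : ℝ) ^ 3) ^ (2 * p) ≠ 0 := pow_ne_zero _ (pow_ne_zero _ hLpos.ne')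
  have hcard_pos : (0 : ℝ) < S.card := by
    rw [hcard]
    positivity
  -- averaging
  have key : rescaledCorrelator (criticalCorr 3) rhoPin (2 * p) (1 / (m : ℝ)) y -
      critBlockMoment (2 * p) L (fun i => (j : ℤ) • z i) *
        (blockCov L 0 / ((L : ℝ) ^ 6 * criticalTwoPoint 3 (Pi.single 0 (m : ℤ)))) ^ p =
      (S.card : ℝ)⁻¹ *
        ∑ x ∈ S, (rescaledCorrelator (criticalCorr 3) rhoPin (2 * p) (1 / (m : ℝ)) y - G x) := by
    rw [Finset.sum_sub_distrib, Finset.sum_const, nsmul_eq_mul, hsum, hcard, mul_sub, ← mul_assoc,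
      ← mul_assoc, inv_mul_cancel₀ hc0, one_mul, one_mul]
  rw [key, abs_mul, abs_inv, abs_of_pos hcard_pos]
  calc (S.card : ℝ)⁻¹ * |∑ x ∈ S, (rescaledCorrelator (criticalCorr 3) rhoPin (2 * p) (1 / (m : ℝ)) y - G x)|
      ≤ (S.card : ℝ)⁻¹ * ∑ x ∈ S, |rescaledCorrelator (criticalCorr 3) rhoPin (2 * p) (1 / (m : ℝ)) y - G x| := by
        gcongr
        exact Finset.abs_sum_le_sum_abs _ _
    _ ≤ (S.card : ℝ)⁻¹ * ∑ _x ∈ S, ε := by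
        gcongr with x hx
        rw [abs_sub_comm]
        exact (hclose x hx).le
    _ = ε := by
        rw [Finset.sum_const, nsmul_eq_mul, ← mul_assoc, inv_mul_cancel₀ hcard_pos.ne', one_mul]

/-! ### The item -/

/-- **BM₂ ∧ BM_mom ⟹ the scale-covariant scaling limit of the critical `ℤ³` Ising correlations exists**
(support item stmt-CriticalPhenomena-17057 of route `MonotoneBlocking`; the equicontinuity hypothesis — the text of
item 4658 `UniformRegularity` — is used for the block→point transfer). BM₂ makes every block two-point ratio monotone
and bounded, hence convergent (`BlockTwoLimits`), which gives two-point scaling (landed S4c); BM_mom does the same for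
the even block moments at sup-separated offsets; de-smearing with block parameter `j ≥ 2` only ever needs such
offsets, so the pinned zoom converges along the integer meshes at every integer configuration, which is the crux
`ExistsScaleCovariantLimit` by the landed `crux_iff_intMeshConvergence`. [folklore] -/
theorem blockingGivesLimit_proof : MonotoneBlocking.BlockingGivesLimit := by
  intro hBM2 hBMM hUR
  exact crux_iff_intMeshConvergence.2
    (intMeshConvergence_of_sepBlockLimits (sepBlockLimits_of_monotoneBlockingMoments hBMM)
      (twoPointScaling_of_blockTwoLimits_holds (blockTwoLimits_of_monotoneBlockingTwo hBM2)) hUR)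

end Summit.CriticalPhenomena.Ising3DConformalLimit.MonotoneBlockingLimit

end
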